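import Mathlib
import HarnessLib
import Summits.HubbardSuperconductivity.HubbardSuperconductivity.Theorems.KLProgrammeKLRegimeEngineResummation
import Summits.HubbardSuperconductivity.HubbardSuperconductivity.Theorems.KLProgrammeKLRegimeTwoPointLimitCooperResummationFlow

/-!
# Route `KLProgramme` — crux K3, engine child `KLRegimeEngineV7` (stmt-HubbardSuperconductivity-19662): the resummed pair array
# `𝒞_{n-1}·N` of (E2-v5) is again a REPULSIVE CONSTANT up to `O(U²)` — `|(𝒞_{n-1}N)(k,k') − cascadeStep W u| ≤ 12·D·U²` on the ball

Cell gate-hubbard-kl, seat hubbard-kl-k3c1-p2; sequel to `…KLRegimeEngineResummation` (`klEngine_resummation_exists`: the implicit-step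
matrix `N` exists and `𝒞_{n-1}N` is entrywise `≤ 6(2|U| + D U²)`).  Here the Sherman–Morrison STRUCTURE theorem of p1's toolkit
(`klcrf_structure`, `…CooperResummationFlow`, p440132) replaces the plain entry bound: with `W = Σ_{ball} w` the resummed array is the
scalar cascade `cascadeStep W u = u/(1 + W u)` of the split's own constant `u ∈ [0, 2|U|]` plus a rest `≤ 12·D·U²`,
`D = P.C_W + klLegKappa·Q.CR·P.Klam³`, uniformly in `W·u` — the form in which an engine proof inserts the resummed ladder into its
second-order remainder terms (a constant vertex plus an `O(U²)` array), and the seed of row 0′'s next comparison constant.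

§1 (abstract): `klres_lift` (block lift `N = N_B ⊕ 1` of a right inverse on the sub-carrier, with `(𝒞N)|_{B×B} = A·N_B`),
**`klres_exists_rightInverse_structure`**.  §2 (model): **`klEngine_resummation_structure`**.  Everything is proved; no definitions.
-/

noncomputable section

namespace Summit.HubbardSuperconductivity.HubbardSuperconductivity.Theorems.KLRegimeSplit

set_option linter.dupNamespace false -- summit = problem name (single-conjunct summit), D-0017

open Finset Matrix Literature.MathematicalPhysics.QuantumLattice Literature.Probability.LatticeModels
open Summit.HubbardSuperconductivity.HubbardSuperconductivity.Theorems.KLProgrammeCooperResummation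
open Summit.HubbardSuperconductivity.HubbardSuperconductivity.Theorems.CooperChannelRiccatiFlow

/-! ## §1 Abstract finite-carrier form -/

section Abstract

variable {S : Type*} [Fintype S] [DecidableEq S]

/-- **Block lift.**  `𝒞` supported on `B × B`, `A = 𝒞|_{B×B}`, and a right inverse `N_B` of `1 + diag w|_B · A` on the sub-carrier
`↥B` give a right inverse `N` of `1 + diag w · 𝒞` on `S` whose resummed array agrees with `A·N_B` on `B × B`. -/
theorem klres_lift (B : Finset S) (w : S → ℝ) (𝒞 : Matrix S S ℂ) (hrow : ∀ s, s ∉ B → ∀ t, 𝒞 s t = 0)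
    (hcol : ∀ t, t ∉ B → ∀ s, 𝒞 s t = 0) (NB : Matrix ↥B ↥B ℂ)
    (hNB : (1 + Matrix.diagonal (fun s : ↥B => (w s.1 : ℂ)) * Matrix.of (fun s t : ↥B => 𝒞 s.1 t.1)) * NB = 1) :
    ∃ N : Matrix S S ℂ, (1 + Matrix.diagonal (fun s => (w s : ℂ)) * 𝒞) * N = 1 ∧
      ∀ s (hs : s ∈ B) t (ht : t ∈ B), (𝒞 * N) s t = (Matrix.of (fun s t : ↥B => 𝒞 s.1 t.1) * NB) ⟨s, hs⟩ ⟨t, ht⟩ := by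
  set A : Matrix ↥B ↥B ℂ := Matrix.of (fun s t : ↥B => 𝒞 s.1 t.1) with hA_def
  have hNBentry : ∀ s t : ↥B, NB s t + (w s.1 : ℂ) * (A * NB) s t = (1 : Matrix ↥B ↥B ℂ) s t := by
    intro s t
    have h := congrFun (congrFun hNB s) t
    rw [Matrix.add_mul, Matrix.one_mul, Matrix.mul_assoc, Matrix.add_apply, Matrix.diagonal_mul] at h
    exact h
  set N : Matrix S S ℂ := fun s t => if h : s ∈ B ∧ t ∈ B then NB ⟨s, h.1⟩ ⟨t, h.2⟩ else (1 : Matrix S S ℂ) s t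
    with hN_def
  have hCN : ∀ s t, (𝒞 * N) s t = if h : s ∈ B ∧ t ∈ B then (A * NB) ⟨s, h.1⟩ ⟨t, h.2⟩ else 0 := by
    intro s t
    by_cases ht : t ∈ B
    · by_cases hs : s ∈ B
      · rw [dif_pos ⟨hs, ht⟩, Matrix.mul_apply, Matrix.mul_apply]
        have h1 : ∑ r, 𝒞 s r * N r t = ∑ r ∈ B, 𝒞 s r * N r t := by
          refine (Finset.sum_subset (Finset.subset_univ B) fun r _ hr => ?_).symm
          rw [hcol r hr s, zero_mul]
        rw [h1, ← Finset.sum_coe_sort B]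
        refine Finset.sum_congr rfl fun r _ => ?_
        have hr : (r : S) ∈ B := r.2
        simp only [hN_def, dif_pos (And.intro hr ht), hA_def, Matrix.of_apply]
      · rw [dif_neg (fun h => hs h.1), Matrix.mul_apply]
        exact Finset.sum_eq_zero fun r _ => by rw [hrow s hs r, zero_mul]
    · rw [dif_neg (fun h => ht h.2), Matrix.mul_apply]
      have h1 : ∀ r, N r t = (1 : Matrix S S ℂ) r t := fun r => by
        simp only [hN_def, dif_neg (fun h : r ∈ B ∧ t ∈ B => ht h.2)]
      simp_rw [h1]
      rw [← Matrix.mul_apply, Matrix.mul_one]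
      exact hcol t ht s
  refine ⟨N, ?_, fun s hs t ht => by rw [hCN s t, dif_pos ⟨hs, ht⟩]⟩
  ext s t
  rw [Matrix.add_mul, Matrix.one_mul, Matrix.mul_assoc, Matrix.add_apply, Matrix.diagonal_mul, hCN s t]
  by_cases h : s ∈ B ∧ t ∈ B
  · rw [dif_pos h]
    have hNst : N s t = NB ⟨s, h.1⟩ ⟨t, h.2⟩ := by simp only [hN_def, dif_pos h]
    rw [hNst, hNBentry ⟨s, h.1⟩ ⟨t, h.2⟩]
    simp only [Matrix.one_apply, Subtype.mk.injEq]
  · rw [dif_neg h, mul_zero, add_zero]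
    simp only [hN_def, dif_neg h]

/-- **The resummed array is the scalar cascade of the constant plus a second-order rest** (abstract form).  `𝒞` supported on
`B × B`, equal to `u ≥ 0` up to `δ` there, weights `w ≥ 0` with `W·δ ≤ 1/3`, `W = Σ_{s ∈ B} w_s`: there is `N` with
`(1 + diag w · 𝒞)·N = 1` and `|(𝒞·N)(s,t) − cascadeStep W u| ≤ 12·δ` for `s, t ∈ B`. -/
theorem klres_exists_rightInverse_structure (B : Finset S) (w : S → ℝ) (hw : ∀ s, 0 ≤ w s) {u δ : ℝ} (hu : 0 ≤ u)
    (hδ : 0 ≤ δ) (𝒞 : Matrix S S ℂ) (hrow : ∀ s, s ∉ B → ∀ t, 𝒞 s t = 0) (hcol : ∀ t, t ∉ B → ∀ s, 𝒞 s t = 0)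
    (hdev : ∀ s ∈ B, ∀ t ∈ B, ‖𝒞 s t - u‖ ≤ δ) (hθ : (∑ s ∈ B, w s) * δ ≤ 1 / 3) :
    ∃ N : Matrix S S ℂ, (1 + Matrix.diagonal (fun s => (w s : ℂ)) * 𝒞) * N = 1 ∧
      ∀ s ∈ B, ∀ t ∈ B, ‖(𝒞 * N) s t - (cascadeStep (∑ s ∈ B, w s) u : ℝ)‖ ≤ 12 * δ := by
  -- the degenerate case `B = ∅`
  rcases B.eq_empty_or_nonempty with hB | hB
  · subst hB
    have h𝒞0 : 𝒞 = 0 := by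
      ext s t
      exact hrow s (Finset.notMem_empty s) t
    refine ⟨1, ?_, fun s hs => absurd hs (Finset.notMem_empty s)⟩
    rw [h𝒞0, Matrix.mul_zero, add_zero, Matrix.one_mul]
  haveI : Nonempty ↥B := hB.coe_sort
  -- the sub-carrier
  set wB : ↥B → ℝ := fun s => w s.1 with hwB_def
  have hwB : ∀ s, 0 ≤ wB s := fun s => hw s.1
  set A : Matrix ↥B ↥B ℂ := Matrix.of (fun s t : ↥B => 𝒞 s.1 t.1) with hA_def
  set 𝒟 : Matrix ↥B ↥B ℂ := A - Matrix.of (fun _ _ : ↥B => (u : ℂ)) with h𝒟_def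
  have h𝒟 : ∀ s t, ‖𝒟 s t‖ ≤ δ := fun s t => by
    simpa [h𝒟_def, hA_def, Matrix.of_apply] using hdev s.1 s.2 t.1 t.2
  have hWB : ∑ s : ↥B, wB s = ∑ s ∈ B, w s := Finset.sum_coe_sort B w
  have hθ' : (∑ s : ↥B, wB s) * δ ≤ 1 / 3 := by rw [hWB]; exact hθ
  obtain ⟨hunit, -, hstruct⟩ := klcrf_structure wB hwB hu hδ 𝒟 h𝒟 hθ'
  have hJA : Matrix.of (fun _ _ : ↥B => (u : ℂ)) + 𝒟 = A := by rw [h𝒟_def]; abel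
  set Dw : Matrix ↥B ↥B ℂ := Matrix.diagonal (fun s => (wB s : ℂ)) with hDw_def
  rw [hJA] at hunit hstruct
  rw [hWB] at hstruct
  -- `1 + Dw·A` is a unit (determinant identity), its inverse, push-through
  have hdet : IsUnit (1 + Dw * A).det := by
    rw [Matrix.det_one_add_mul_comm]
    exact (Matrix.isUnit_iff_isUnit_det _).1 hunit
  set NB : Matrix ↥B ↥B ℂ := (1 + Dw * A)⁻¹ with hNB_def
  have hNB : (1 + Dw * A) * NB = 1 := Matrix.mul_nonsing_inv _ hdet
  have hANB : A * NB = (1 + A * Dw)⁻¹ * A := klres_push_through A Dw NB hunit hNB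
  -- lift
  obtain ⟨N, hN, hCN⟩ := klres_lift B w 𝒞 hrow hcol NB hNB
  refine ⟨N, hN, fun s hs t ht => ?_⟩
  rw [hCN s hs t ht, ← hA_def, hANB]
  exact hstruct ⟨s, hs⟩ ⟨t, ht⟩

end Abstract

/-! ## §2 The engine-side corollary on the torus carrier -/

section Model

variable (L M : ℕ) [NeZero L] [NeZero M]

/-- **The resummed pair array of (E2-v5) is a repulsive constant up to `12·D·U²`.**  From the history's split slot
`PairArrayAtV2 … m` (constant `u ∈ [0, 2|U|]` at total momentum `Qm`, tolerance `D·U²`, `D = P.C_W + klLegKappa·Q.CR·P.Klam³`) and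
weights `w ≥ 0` with `(Σ w)·D·U² ≤ 1/3`: there are that constant `u` and a matrix `N` with `(1 + diag w · klPairArray … m Qm)·N = 1`
and, on the ball, `|(klPairArray … m Qm · N)(k,k') − cascadeStep W u| ≤ 12·D·U²`, `W = Σ_{klBall} w` — the resummed array is the
one-step scalar cascade `u/(1 + W u) ∈ [0, u]` of the split's constant plus a second-order rest. -/
theorem klEngine_resummation_structure {P : SplitConsts} {Q : EngConsts} {β U μ : ℝ} {K : TrigPolyC4v} {m : ℕ}
    (hsplit : PairArrayAtV2 L M P Q β U μ K m) (w : TorusSite 2 L → ℝ) (hw : ∀ p, 0 ≤ w p)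
    (hθ : (∑ p, w p) * ((P.C_W + klLegKappa * Q.CR * P.Klam ^ 3) * U ^ 2) ≤ 1 / 3)
    (hD : 0 ≤ P.C_W + klLegKappa * Q.CR * P.Klam ^ 3) (Qm : TorusSite 2 L) :
    ∃ u : ℝ, 0 ≤ u ∧ u ≤ 2 * |U| ∧ 0 ≤ cascadeStep (∑ p ∈ klBall L μ K, w p) u ∧
      cascadeStep (∑ p ∈ klBall L μ K, w p) u ≤ u ∧
      ∃ N : Matrix (TorusSite 2 L) (TorusSite 2 L) ℂ,
        (1 + Matrix.diagonal (fun p => (w p : ℂ)) * klPairArray L M β U μ K m Qm) * N = 1 ∧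
        ∀ k ∈ klBall L μ K, ∀ k' ∈ klBall L μ K,
          ‖(klPairArray L M β U μ K m Qm * N) k k' - (cascadeStep (∑ p ∈ klBall L μ K, w p) u : ℝ)‖ ≤
            12 * ((P.C_W + klLegKappa * Q.CR * P.Klam ^ 3) * U ^ 2) := by
  obtain ⟨u, hu0, hu2, hball⟩ := hsplit Qm
  set δ : ℝ := (P.C_W + klLegKappa * Q.CR * P.Klam ^ 3) * U ^ 2 with hδ_def
  have hδ : 0 ≤ δ := mul_nonneg hD (sq_nonneg U)
  set W : ℝ := ∑ p ∈ klBall L μ K, w p with hW_def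
  have hW : 0 ≤ W := sum_nonneg fun p _ => hw p
  have hrow : ∀ s, s ∉ klBall L μ K → ∀ t, klPairArray L M β U μ K m Qm s t = 0 :=
    fun s hs t => klPairArray_apply_of_not_mem L M β U μ K m Qm hs t
  have hcol : ∀ t, t ∉ klBall L μ K → ∀ s, klPairArray L M β U μ K m Qm s t = 0 :=
    fun t ht s => by simp [klPairArray, ht]
  have hdev : ∀ s ∈ klBall L μ K, ∀ t ∈ klBall L μ K, ‖klPairArray L M β U μ K m Qm s t - u‖ ≤ δ := by
    intro s hs t ht
    rw [klPairArray_apply_of_mem L M β U μ K m Qm hs ht]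
    exact hball s hs t ht
  have hθ' : W * δ ≤ 1 / 3 := by
    have h1 : W ≤ ∑ s, w s := Finset.sum_le_sum_of_subset_of_nonneg (Finset.subset_univ _) fun s _ _ => hw s
    exact (mul_le_mul_of_nonneg_right h1 hδ).trans hθ
  obtain ⟨N, hN, hent⟩ := klres_exists_rightInverse_structure (klBall L μ K) w hw hu0 hδ _ hrow hcol hdev hθ'
  have hWu : 0 ≤ W * u := mul_nonneg hW hu0
  have hcs : cascadeStep W u = u / (1 + W * u) := rfl
  refine ⟨u, hu0, hu2, ?_, ?_, N, hN, fun k hk k' hk' => hent k hk k' hk'⟩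
  · rw [hcs]; exact div_nonneg hu0 (by linarith)
  · rw [hcs]; exact div_le_self hu0 (by linarith)

end Model

end Summit.HubbardSuperconductivity.HubbardSuperconductivity.Theorems.KLRegimeSplit

end
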